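import Summits.CriticalPhenomena.Ising3D.Control2DRhoStates
import Summits.CriticalPhenomena.Ising3D.Control2DConvergenceRateSharp
import Mathlib.Analysis.SpecialFunctions.Pow.Real
import Mathlib.Analysis.SpecialFunctions.Pow.Continuity
import Mathlib.Tactic.Linarith
import Mathlib.Tactic.Positivity
import Mathlib.Tactic.FieldSimp
import Mathlib.Tactic.Ring
import HarnessLib

/-!
# The weighted spectral density of the `ρ`-frame, exactly: `F_ρ(E) ∼ 16^s(1 + 2P₀)·E^{4Δ_σ}/Γ(4Δ_σ+1)`, and the rate `ρ(x₀)^E` with the exact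
# prefactor — Pappadopulo–Rychkov–Espin–Rattazzi 2012 §5.2 for the typed class
(cell `pub-ising3x`, seat controls-1 gen 48; PAPER §6.2 / Appendix E — CONTROL-ONLY; part 2 of 2, part 1 is `Control2DRhoStates`;
the `ρ`-frame twin of E.1u's `Control2DSpectralDensityAsymptotics` and E.1w's `Control2DConvergenceRateSharp`)

HONEST FRAMING: lottery ticket; floor = tightest certified 3D Ising CFT bounds; no exact-solution
claim without a proof. CONTROL-ONLY (`d = 2`, global `sl(2) × sl(2)` blocks, `Δ_σ = s` an INPUT, axiom set `A2D′`);
nothing here is about `d = 3`, no certificate, functional or number of the record is touched, and no new hypothesis,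
definition or named fact enters.

WHAT THIS FILE ADDS. For every unitary solution `D` of the typed `⟨σσσσ⟩` sum rule at external dimension `Δ_σ = s > 0`:

* **`CrossingData.tendsto_rpow_mul_rhoLaplace`** — the Laplace hypothesis of the `ρ`-frame: `t^{4s}·Σ_j w_j e^{-t·level_j} → 16^s(1 + 2P₀)`
  as `t ↓ 0` (`P₀ = Σ'_{Δ_i = 0} p_i`): E.1r's corner asymptotics `((1-x)(1-x))^s G(x,x) → 1 + 2P₀` (`tendsto_fourPoint_corner`) along
  `x = z(e^{-t}) = 4e^{-t}/(1+e^{-t})²`, with `1 - x = ((1-e^{-t})/(1+e^{-t}))²` and `t(1+e^{-t})/(1-e^{-t}) → 2`;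
* **`CrossingData.tendsto_rhoSpectralCount_div_rpow`** — **`F_ρ(E)/E^{4s} → 16^s(1 + 2P₀)/Γ(4s+1)` as `E → ∞`**: the tree's Karamata
  Tauberian theorem through E.1u's `tendsto_tsum_le_div_rpow_of_tendsto`, BY NAME, with exponent `4s` — the Tauberian EQUALITY of the
  `ρ`-frame for the typed class, two-sided (E.1u: the `x`-frame count grows like `E^{2s}`; here the `ρ`-frame count grows EXACTLY like
  `E^{4s}`, the doubling of the exponent PRER point out); `_of_pos` / `_of_hasScalarGap`: `→ 16^s/Γ(4s+1)` when no weight sits at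
  dimension `0`;
* **`eventually_tsum_p_four_rpow_le`** — the primaries alone: eventually `Σ'_{Δ_i ≤ E} p_i 4^{Δ_i} ≤ (16^s(1+2P₀)/(2Γ(4s+1)) + ε)E^{4s}`
  (E.1x's hypothesis-free `½e^{4s}16^s((E+2s)/(4s))^{4s}G(½,½)` sharpened asymptotically to the Tauberian constant; upper bound only);
* `eventually_tsum_rhoWeight_le`, **`eventually_rhoStatesTail_le`** (E.1w's asymptotic Abelian lemma `eventually_tsum_ge_mul_exp_le` BY NAME),
  `rhoTail_le_rhoStatesTail`, **`eventually_rhoTail_le_sharp`** — for every `ρ₀ ∈ (0,1)` and `ε > 0`, eventually in `E`: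
  `Σ'_{Δ_i ≥ E} p_i g_i(x₀,x₀) ≤ (16^s(1+2P₀)/Γ(4s+1) + ε)·E^{4s}·ρ₀^E` at `x₀ = 4ρ₀/(1+ρ₀)²` — PRER's (5.4)
  «`≲ Δ_*^{4Δ_φ}|ρ(z)|^{Δ_*}/Γ(4Δ_φ+1)`» with THEIR PREFACTOR EXACTLY (E.1z's hypothesis-free `2(1-ρ₀²)^{-1}·B·E^{4s}ρ₀^E·Et/(Et-4s)` sharpened
  asymptotically); `_of_pos`, `_rhoZ` (every `x₀ ∈ (0,1)`, `ρ(x₀)` written out);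
* `record_rhoSpectralCount (w)` — at `Δ_σ = 1/8` on the record's class (all labels `≥ 0.99`, `P₀ = 0`): `F_ρ(E)/E^{1/2} → 16^{1/8}/Γ(3/2)`
  (`= 2√(2/π) ≈ 1.596` [decimal for orientation]) and eventually `Σ'_{Δ_i ≥ E} p_i g_i(½,½) ≤ (16^{1/8}/Γ(3/2) + ε)·E^{1/2}·ρ(½)^E`,
  `ρ(½) = 3 - 2√2`.

NOT claimed: PRER's error terms / Korevaar's logarithmic remainder; any LOWER bound pointwise in `E` on a tail or on the primaries' count
(the levels may leave gaps); a bound on a single `p_i` beyond E.1x/E.1z; anything off the REAL diagonal / square (complex `ρ`, the cut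
plane — where PRER's statement lives in full); anything at `s = 0` (E.1q); Virasoro; anything three-dimensional; any bound on `Δ_ε`, `c`
or `λ²`; nothing of the record touched, no new hypothesis or named fact.

References: D. Pappadopulo, S. Rychkov, J. Espin, R. Rattazzi, Phys. Rev. D 86 (2012) 105043, §5.2 eq. (5.3)–(5.4)
[cite: PappadopuloRychkovEspinRattazzi2012PRD, §5.2]. Tree: `rhoWeight`, `rhoLevel`, `rhoSpectralCount`, `hasSum_rhoStates(_fiber)`,
`hasSum_rhoLaplace`, `tsum_p_four_rpow_le_rhoSpectralCount` (`Control2DRhoStates`); `tendsto_tsum_le_div_rpow_of_tendsto`, `tsum_p_dim_zero_eq_zero`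
(`Control2DSpectralDensityAsymptotics`); `eventually_tsum_ge_mul_exp_le` (`Control2DAbelianTail`); `tendsto_fourPoint_corner`
(`Control2DCornerAsymptotics`); `one_sub_four_mul_div_sq`, `four_mul_div_sq_mem_Ioo`, `rhoZ_mem_Ioo`, `four_mul_rhoZ_div_sq`
(`Control2DRhoCoordinate`); `two_le_of_spin_ne_zero`, `lowerBound_of_location`, `twoSided_2d_kernel099` (the record, by name), `opeConvergent_free`.
Mathlib: `Real.Gamma`, `tendsto_nhdsWithin_of_tendsto_nhds_of_eventually_within`, `tendsto_of_tendsto_of_tendsto_of_le_of_le'`,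
`Real.continuous_rpow_const`, `tendsto_rpow_atTop`, `Metric.tendsto_nhds`, `Summable.tsum_prod`, `Set.indicator`.
-/

namespace Summit.CriticalPhenomena.Ising3D.Control2D

open Set Filter Topology
open Literature.MathematicalPhysics.QuantumFieldTheory.ConformalBootstrap3D

namespace CrossingData

variable {D : CrossingData} {s : ℝ}

/-- **The Laplace hypothesis in the `ρ`-frame**: for every unitary solution of the typed sum rule at `Δ_σ = s > 0`,
`t^{4s} · Σ_{(i,n,n')} w e^{-t·level} → 16^s · (1 + 2·Σ'_{Δ_i = 0} p_i)` as `t ↓ 0` — E.1r's corner asymptotics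
`((1-x)(1-x))^s G(x,x) → 1 + 2P₀` along `x = z(e^{-t}) = 4e^{-t}/(1+e^{-t})²`, with `1 - x = ((1-e^{-t})/(1+e^{-t}))²` and
`t(1+e^{-t})/(1-e^{-t}) → 2`. [cite: PappadopuloRychkovEspinRattazzi2012PRD, §5.2] -/
theorem tendsto_rpow_mul_rhoLaplace (hU : D.IsUnitary) (hC : D.SatisfiesCrossing s) (hs : 0 < s) :
    Tendsto (fun t : ℝ => t ^ (4 * s) * ∑' j : D.ι × ℕ × ℕ, D.rhoWeight j * Real.exp (-(t * D.rhoLevel j)))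
      (𝓝[>] 0) (𝓝 ((16 : ℝ) ^ s * (1 + 2 * ∑' i : ↥({i : D.ι | D.Δ i = 0} : Set D.ι), D.p i))) := by
  set L : ℝ := 1 + 2 * ∑' i : ↥({i : D.ι | D.Δ i = 0} : Set D.ι), D.p i with hL
  have hconv := opeConvergent_free hU hC hs
  have hden : ∀ t : ℝ, 0 < t → 0 < 1 - Real.exp (-t) := fun t ht => by
    have := Real.exp_lt_one_iff.mpr (show -t < 0 by linarith)
    linarith
  have hρI : ∀ t : ℝ, 0 < t → Real.exp (-t) ∈ Ioo (0 : ℝ) 1 := fun t ht =>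
    ⟨Real.exp_pos _, Real.exp_lt_one_iff.mpr (by linarith)⟩
  -- `x(t) = 4e^{-t}/(1+e^{-t})²` maps `𝓝[>] 0` into `𝓝[<] 1`
  have hφ : Tendsto (fun t : ℝ => 4 * Real.exp (-t) / (1 + Real.exp (-t)) ^ 2) (𝓝[>] 0) (𝓝[<] 1) := by
    refine tendsto_nhdsWithin_of_tendsto_nhds_of_eventually_within _ ?_ ?_
    · have hc : Continuous fun t : ℝ => 4 * Real.exp (-t) / (1 + Real.exp (-t)) ^ 2 :=
        (continuous_const.mul (Real.continuous_exp.comp continuous_neg)).div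
          ((continuous_const.add (Real.continuous_exp.comp continuous_neg)).pow 2)
          (fun t => by positivity)
      have h0 := hc.tendsto 0
      rw [neg_zero, Real.exp_zero] at h0
      norm_num at h0
      exact h0.mono_left nhdsWithin_le_nhds
    · filter_upwards [self_mem_nhdsWithin] with t ht
      exact (four_mul_div_sq_mem_Ioo (hρI t ht)).2
  have A : Tendsto (fun t : ℝ => ((1 - 4 * Real.exp (-t) / (1 + Real.exp (-t)) ^ 2) *
      (1 - 4 * Real.exp (-t) / (1 + Real.exp (-t)) ^ 2)) ^ s *
      D.fourPoint (4 * Real.exp (-t) / (1 + Real.exp (-t)) ^ 2) (4 * Real.exp (-t) / (1 + Real.exp (-t)) ^ 2))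
      (𝓝[>] 0) (𝓝 L) :=
    (tendsto_fourPoint_corner hU hC hs).comp hφ
  -- `t/(1 - e^{-t}) → 1` (squeezed between `1` and `1 + t`) and `1 + e^{-t} → 2`
  have hr : Tendsto (fun t : ℝ => t / (1 - Real.exp (-t))) (𝓝[>] 0) (𝓝 1) := by
    have hup : Tendsto (fun t : ℝ => 1 + t) (𝓝[>] 0) (𝓝 1) := by
      have h0 : Tendsto (fun t : ℝ => 1 + t) (𝓝 0) (𝓝 (1 + 0)) := (continuous_const.add continuous_id).tendsto 0
      rw [add_zero] at h0
      exact h0.mono_left nhdsWithin_le_nhds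
    refine tendsto_of_tendsto_of_tendsto_of_le_of_le' tendsto_const_nhds hup ?_ ?_
    · filter_upwards [self_mem_nhdsWithin] with t ht
      have ht0 : 0 < t := ht
      rw [le_div_iff₀ (hden t ht0), one_mul]
      linarith [Real.add_one_le_exp (-t)]
    · filter_upwards [self_mem_nhdsWithin] with t ht
      have ht0 : 0 < t := ht
      rw [div_le_iff₀ (hden t ht0)]
      have h1 := Real.add_one_le_exp t
      have h3 : 0 < Real.exp (-t) := Real.exp_pos _
      have h2 : Real.exp t * Real.exp (-t) = 1 := by rw [← Real.exp_add, add_neg_cancel, Real.exp_zero]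
      have h4 : (t + 1) * Real.exp (-t) ≤ Real.exp t * Real.exp (-t) := mul_le_mul_of_nonneg_right h1 h3.le
      rw [h2] at h4
      nlinarith
  have h1p : Tendsto (fun t : ℝ => 1 + Real.exp (-t)) (𝓝[>] 0) (𝓝 2) := by
    have h0 : Tendsto (fun t : ℝ => 1 + Real.exp (-t)) (𝓝 0) (𝓝 (1 + Real.exp (-0))) :=
      (continuous_const.add (Real.continuous_exp.comp continuous_neg)).tendsto 0
    rw [neg_zero, Real.exp_zero, show (1 : ℝ) + 1 = 2 by norm_num] at h0
    exact h0.mono_left nhdsWithin_le_nhds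
  have hQ : Tendsto (fun t : ℝ => t / (1 - Real.exp (-t)) * (1 + Real.exp (-t))) (𝓝[>] 0) (𝓝 2) := by
    have h := hr.mul h1p
    rw [one_mul] at h
    exact h
  have hQ4 : Tendsto (fun t : ℝ => ((t / (1 - Real.exp (-t)) * (1 + Real.exp (-t))) *
      (t / (1 - Real.exp (-t)) * (1 + Real.exp (-t))) *
      ((t / (1 - Real.exp (-t)) * (1 + Real.exp (-t))) * (t / (1 - Real.exp (-t)) * (1 + Real.exp (-t))))) ^ s)
      (𝓝[>] 0) (𝓝 ((16 : ℝ) ^ s)) := by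
    have hc : Tendsto (fun y : ℝ => (y * y * (y * y)) ^ s) (𝓝 2) (𝓝 (((2 : ℝ) * 2 * (2 * 2)) ^ s)) :=
      ((Real.continuous_rpow_const hs.le).comp ((continuous_id.mul continuous_id).mul
        (continuous_id.mul continuous_id))).tendsto 2
    rw [show (2 : ℝ) * 2 * (2 * 2) = 16 by norm_num] at hc
    exact hc.comp hQ
  have hz : Tendsto (fun t : ℝ => t ^ (4 * s)) (𝓝[>] 0) (𝓝 0) := by
    have hc : Tendsto (fun t : ℝ => t ^ (4 * s)) (𝓝 0) (𝓝 ((0 : ℝ) ^ (4 * s))) :=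
      (Real.continuous_rpow_const (by linarith)).tendsto 0
    rw [Real.zero_rpow (by linarith)] at hc
    exact hc.mono_left nhdsWithin_le_nhds
  have hmain := (hQ4.mul A).sub hz
  rw [sub_zero] at hmain
  refine hmain.congr' ?_
  filter_upwards [self_mem_nhdsWithin] with t ht
  have ht0 : 0 < t := ht
  have hd := hden t ht0
  set ρ : ℝ := Real.exp (-t) with hρdef
  have hρ0 : 0 < ρ := Real.exp_pos _
  have h1ρ : 0 < 1 + ρ := by linarith
  have hQpos : 0 < t / (1 - ρ) * (1 + ρ) := by positivity
  rw [(hasSum_rhoLaplace hU hconv ht0).tsum_eq, one_sub_four_mul_div_sq hρ0.le]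
  have hq0 : 0 ≤ ((1 - ρ) / (1 + ρ)) ^ 2 := sq_nonneg _
  have key : ((t / (1 - ρ) * (1 + ρ)) * (t / (1 - ρ) * (1 + ρ)) *
      ((t / (1 - ρ) * (1 + ρ)) * (t / (1 - ρ) * (1 + ρ)))) ^ s *
      (((1 - ρ) / (1 + ρ)) ^ 2 * ((1 - ρ) / (1 + ρ)) ^ 2) ^ s = t ^ (4 * s) := by
    rw [← Real.mul_rpow (by positivity) (mul_nonneg hq0 hq0)]
    have e1 : (t / (1 - ρ) * (1 + ρ)) * (t / (1 - ρ) * (1 + ρ)) * ((t / (1 - ρ) * (1 + ρ)) * (t / (1 - ρ) * (1 + ρ))) *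
        (((1 - ρ) / (1 + ρ)) ^ 2 * ((1 - ρ) / (1 + ρ)) ^ 2) = t ^ (4 : ℕ) := by
      field_simp
    rw [e1, ← Real.rpow_natCast, ← Real.rpow_mul ht0.le]
    norm_num
  show ((t / (1 - ρ) * (1 + ρ)) * (t / (1 - ρ) * (1 + ρ)) * ((t / (1 - ρ) * (1 + ρ)) * (t / (1 - ρ) * (1 + ρ)))) ^ s *
      ((((1 - ρ) / (1 + ρ)) ^ 2 * ((1 - ρ) / (1 + ρ)) ^ 2) ^ s *
        D.fourPoint (4 * ρ / (1 + ρ) ^ 2) (4 * ρ / (1 + ρ) ^ 2)) - t ^ (4 * s) =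
    t ^ (4 * s) * (D.fourPoint (4 * ρ / (1 + ρ) ^ 2) (4 * ρ / (1 + ρ) ^ 2) - 1)
  rw [← mul_assoc, key]
  ring

/-- **The weighted spectral density in the `ρ`-frame, exactly — the Tauberian EQUALITY of Pappadopulo–Rychkov–Espin–Rattazzi
2012 §5 for the typed class.** For every unitary solution of the typed `⟨σσσσ⟩` sum rule at `Δ_σ = s > 0`:
`F_ρ(E)/E^{4s} → 16^s·(1 + 2·Σ'_{Δ_i = 0} p_i)/Γ(4s+1)` as `E → ∞` (`F_ρ = rhoSpectralCount`): Karamata's Tauberian theorem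
(the tree's `karamata_tauberian_measure_of_tendsto_rpow_mul` through E.1u's `tendsto_tsum_le_div_rpow_of_tendsto`, by name) on
`tendsto_rpow_mul_rhoLaplace`; two-sided — the weighted number of `ρ`-states below `E` grows EXACTLY like `E^{4Δ_σ}` (E.1u: the
`x`-frame count grows like `E^{2Δ_σ}`). [cite: PappadopuloRychkovEspinRattazzi2012PRD, §5.2] -/
theorem tendsto_rhoSpectralCount_div_rpow (hU : D.IsUnitary) (hC : D.SatisfiesCrossing s) (hs : 0 < s) :
    Tendsto (fun E : ℝ => D.rhoSpectralCount E / E ^ (4 * s)) atTop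
      (𝓝 ((16 : ℝ) ^ s * (1 + 2 * ∑' i : ↥({i : D.ι | D.Δ i = 0} : Set D.ι), D.p i) / Real.Gamma (4 * s + 1))) := by
  have hconv := opeConvergent_free hU hC hs
  have K := tendsto_tsum_le_div_rpow_of_tendsto (rhoWeight_nonneg hU) (rhoLevel_nonneg hU)
    (fun t ht => (hasSum_rhoLaplace hU hconv ht).summable) (by linarith : 0 ≤ 4 * s)
    (tendsto_rpow_mul_rhoLaplace hU hC hs)
  have Z : Tendsto (fun E : ℝ => 1 / E ^ (4 * s)) atTop (𝓝 0) :=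
    tendsto_const_nhds.div_atTop (tendsto_rpow_atTop (by linarith))
  have h := Z.add K
  rw [zero_add] at h
  refine h.congr' (Eventually.of_forall fun E => ?_)
  show 1 / E ^ (4 * s) +
      (∑' j : ↥({j : D.ι × ℕ × ℕ | D.rhoLevel j ≤ E} : Set (D.ι × ℕ × ℕ)), D.rhoWeight j) / E ^ (4 * s) =
    D.rhoSpectralCount E / E ^ (4 * s)
  rw [rhoSpectralCount, add_div]

/-- **No weight at dimension zero: `F_ρ(E)/E^{4s} → 16^s/Γ(4s+1)`** (any scalar gap; every class of the record).
[cite: PappadopuloRychkovEspinRattazzi2012PRD, §5.2] -/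
theorem tendsto_rhoSpectralCount_div_rpow_of_pos (hU : D.IsUnitary) (hC : D.SatisfiesCrossing s) (hs : 0 < s)
    (hpos : ∀ i, D.p i ≠ 0 → 0 < D.Δ i) :
    Tendsto (fun E : ℝ => D.rhoSpectralCount E / E ^ (4 * s)) atTop (𝓝 ((16 : ℝ) ^ s / Real.Gamma (4 * s + 1))) := by
  have h := tendsto_rhoSpectralCount_div_rpow hU hC hs
  rw [tsum_p_dim_zero_eq_zero hpos, mul_zero, add_zero, mul_one] at h
  exact h

/-- **Under a scalar gap `U > 0`: `F_ρ(E)/E^{4s} → 16^s/Γ(4s+1)`.** [cite: PappadopuloRychkovEspinRattazzi2012PRD, §5.2] -/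
theorem tendsto_rhoSpectralCount_div_rpow_of_hasScalarGap (hU : D.IsUnitary) (hC : D.SatisfiesCrossing s)
    (hs : 0 < s) {U : ℝ} (hgap : D.HasScalarGap U) (hU0 : 0 < U) :
    Tendsto (fun E : ℝ => D.rhoSpectralCount E / E ^ (4 * s)) atTop (𝓝 ((16 : ℝ) ^ s / Real.Gamma (4 * s + 1))) := by
  refine tendsto_rhoSpectralCount_div_rpow_of_pos hU hC hs fun i _ => ?_
  by_cases h0 : D.spin i = 0
  · exact lt_of_lt_of_le hU0 (hgap i h0)
  · exact lt_of_lt_of_le (by norm_num) (two_le_of_spin_ne_zero hU h0)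

/-! ### The primaries alone, asymptotically, in the `4^Δ` normalisation -/

/-- **Asymptotic density of the quasi-primaries in the `4^Δ` normalisation**: for every unitary solution of the typed sum rule at
`Δ_σ = s > 0` and every `ε > 0`, eventually `Σ'_{Δ_i ≤ E} p_i 4^{Δ_i} ≤ (16^s(1 + 2P₀)/(2Γ(4s+1)) + ε) · E^{4s}` — E.1x's
hypothesis-free `½e^{4s}16^s((E+2s)/(4s))^{4s}G(½,½)` sharpened asymptotically to the Tauberian constant (upper bound only).
[cite: PappadopuloRychkovEspinRattazzi2012PRD, §5.2] -/
theorem eventually_tsum_p_four_rpow_le (hU : D.IsUnitary) (hC : D.SatisfiesCrossing s) (hs : 0 < s) {ε : ℝ} (hε : 0 < ε) :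
    ∀ᶠ E : ℝ in atTop, ∑' i : ↥({i : D.ι | D.Δ i ≤ E} : Set D.ι), D.p i * (4 : ℝ) ^ D.Δ (i : D.ι) ≤
      ((16 : ℝ) ^ s * (1 + 2 * ∑' i : ↥({i : D.ι | D.Δ i = 0} : Set D.ι), D.p i) / (2 * Real.Gamma (4 * s + 1)) + ε) *
        E ^ (4 * s) := by
  set c : ℝ := (16 : ℝ) ^ s * (1 + 2 * ∑' i : ↥({i : D.ι | D.Δ i = 0} : Set D.ι), D.p i) / Real.Gamma (4 * s + 1)
    with hc
  have h := tendsto_rhoSpectralCount_div_rpow hU hC hs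
  have hev := (Metric.tendsto_nhds.mp h) (2 * ε) (by positivity)
  filter_upwards [hev, eventually_gt_atTop 0] with E hE hE0
  set X : ℝ := E ^ (4 * s) with hX
  have hXpos : 0 < X := Real.rpow_pos_of_pos hE0 _
  rw [Real.dist_eq, abs_lt] at hE
  have h2 : D.rhoSpectralCount E < (c + 2 * ε) * X := by
    have h3 : D.rhoSpectralCount E / X < c + 2 * ε := by linarith [hE.2]
    exact (div_lt_iff₀ hXpos).mp h3
  have h4 := tsum_p_four_rpow_le_rhoSpectralCount hU (opeConvergent_free hU hC hs) E
  have hc2 : (16 : ℝ) ^ s * (1 + 2 * ∑' i : ↥({i : D.ι | D.Δ i = 0} : Set D.ι), D.p i) /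
      (2 * Real.Gamma (4 * s + 1)) = c / 2 := by
    rw [hc]; ring
  rw [hc2]
  nlinarith [h2, h4, hXpos, hε]

/-! ### The rate with the exact prefactor -/

/-- For every `δ > 0`, eventually `Σ'_{level ≤ u} w = F_ρ(u) - 1 ≤ (16^s(1+2P₀)/Γ(4s+1) + δ) u^{4s}`. [folklore] -/
theorem eventually_tsum_rhoWeight_le (hU : D.IsUnitary) (hC : D.SatisfiesCrossing s) (hs : 0 < s)
    {δ : ℝ} (hδ : 0 < δ) :
    ∀ᶠ u : ℝ in atTop, ∑' j : ↥({j : D.ι × ℕ × ℕ | D.rhoLevel j ≤ u} : Set (D.ι × ℕ × ℕ)), D.rhoWeight j ≤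
      ((16 : ℝ) ^ s * (1 + 2 * ∑' i : ↥({i : D.ι | D.Δ i = 0} : Set D.ι), D.p i) / Real.Gamma (4 * s + 1) + δ) *
        u ^ (4 * s) := by
  set c : ℝ := (16 : ℝ) ^ s * (1 + 2 * ∑' i : ↥({i : D.ι | D.Δ i = 0} : Set D.ι), D.p i) / Real.Gamma (4 * s + 1)
    with hc
  have h := tendsto_rhoSpectralCount_div_rpow hU hC hs
  have hev := (Metric.tendsto_nhds.mp h) δ hδ
  filter_upwards [hev, eventually_gt_atTop 0] with u hu hu0
  have hX : 0 < u ^ (4 * s) := Real.rpow_pos_of_pos hu0 _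
  rw [Real.dist_eq, abs_lt] at hu
  have h2 : D.rhoSpectralCount u < (c + δ) * u ^ (4 * s) := by
    have h3 : D.rhoSpectralCount u / u ^ (4 * s) < c + δ := by linarith [hu.2]
    exact (div_lt_iff₀ hX).mp h3
  have h4 : ∑' j : ↥({j : D.ι × ℕ × ℕ | D.rhoLevel j ≤ u} : Set (D.ι × ℕ × ℕ)), D.rhoWeight j =
      D.rhoSpectralCount u - 1 := by rw [rhoSpectralCount]; ring
  rw [h4]
  linarith

/-- **The sharp rate for the `ρ`-states**: for every unitary solution at `Δ_σ = s > 0`, every `ρ₀ ∈ (0,1)` and `ε > 0`, eventually in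
`E`: `Σ'_{j : E ≤ level_j} w_j ρ₀^{level_j} ≤ (16^s(1+2P₀)/Γ(4s+1) + ε) · E^{4s} · ρ₀^E` (E.1w's asymptotic Abelian lemma
`eventually_tsum_ge_mul_exp_le` by name, `t = log(1/ρ₀)`). [cite: PappadopuloRychkovEspinRattazzi2012PRD, §5.2] -/
theorem eventually_rhoStatesTail_le (hU : D.IsUnitary) (hC : D.SatisfiesCrossing s) (hs : 0 < s) {ρ₀ : ℝ}
    (hρ₀ : ρ₀ ∈ Ioo (0 : ℝ) 1) {ε : ℝ} (hε : 0 < ε) :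
    ∀ᶠ E : ℝ in atTop,
      ∑' j : ↥({j : D.ι × ℕ × ℕ | E ≤ D.rhoLevel j} : Set (D.ι × ℕ × ℕ)), D.rhoWeight j * ρ₀ ^ D.rhoLevel j ≤
        ((16 : ℝ) ^ s * (1 + 2 * ∑' i : ↥({i : D.ι | D.Δ i = 0} : Set D.ι), D.p i) / Real.Gamma (4 * s + 1) + ε) *
          E ^ (4 * s) * ρ₀ ^ E := by
  have ht : 0 < -Real.log ρ₀ := neg_pos.mpr (Real.log_neg hρ₀.1 hρ₀.2)
  have hxt : ∀ y : ℝ, ρ₀ ^ y = Real.exp (-(-Real.log ρ₀ * y)) := fun y => by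
    rw [Real.rpow_def_of_pos hρ₀.1, neg_mul, neg_neg]
  have hconv := opeConvergent_free hU hC hs
  have key := eventually_tsum_ge_mul_exp_le (w := D.rhoWeight) (E := D.rhoLevel) (rhoWeight_nonneg hU)
    (fun t ht' => (hasSum_rhoLaplace hU hconv ht').summable) (by linarith : (0 : ℝ) ≤ 4 * s) ht
    (fun δ hδ => eventually_tsum_rhoWeight_le hU hC hs hδ) hε
  simp only [hxt]
  exact key

/-- **The primaries above `E` weigh less than the `ρ`-states above `E`**: for unitary OPE-convergent data and `ρ₀ ∈ (0,1)`,
`Σ'_{i : E ≤ Δ_i} p_i g_i(x₀,x₀) ≤ Σ'_{j : E ≤ level_j} w_j ρ₀^{level_j}` at `x₀ = 4ρ₀/(1+ρ₀)²` — every `ρ`-state `(i,n,n')` of a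
quasi-primary of dimension `≥ E` has level `Δ_i + 2n + 2n' ≥ E` (fibrewise sums `hasSum_rhoStates_fiber`; indicators). [folklore] -/
theorem rhoTail_le_rhoStatesTail (hU : D.IsUnitary) (hconv : D.OpeConvergent) {ρ₀ : ℝ} (hρ₀ : ρ₀ ∈ Ioo (0 : ℝ) 1) (E : ℝ) :
    ∑' i : ↥({i : D.ι | E ≤ D.Δ i} : Set D.ι),
        D.p i * globalBlock (D.Δ i) (D.spin i) (4 * ρ₀ / (1 + ρ₀) ^ 2) (4 * ρ₀ / (1 + ρ₀) ^ 2) ≤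
      ∑' j : ↥({j : D.ι × ℕ × ℕ | E ≤ D.rhoLevel j} : Set (D.ι × ℕ × ℕ)), D.rhoWeight j * ρ₀ ^ D.rhoLevel j := by
  set x : ℝ := 4 * ρ₀ / (1 + ρ₀) ^ 2 with hx
  set f : D.ι × ℕ × ℕ → ℝ := fun j => D.rhoWeight j * ρ₀ ^ D.rhoLevel j with hf
  have hf0 : ∀ j, 0 ≤ f j := fun j => mul_nonneg (rhoWeight_nonneg hU j) (Real.rpow_nonneg hρ₀.1.le _)
  have hS : Summable f := (hasSum_rhoStates hU hconv hρ₀).summable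
  set A : Set (D.ι × ℕ × ℕ) := {j | E ≤ D.Δ j.1} with hA
  set B : Set (D.ι × ℕ × ℕ) := {j | E ≤ D.rhoLevel j} with hB
  have hAB : A ⊆ B := fun j hj => by
    have h1 : E ≤ D.Δ j.1 := hj
    have h2 : (0 : ℝ) ≤ j.2.1 := Nat.cast_nonneg _
    have h3 : (0 : ℝ) ≤ j.2.2 := Nat.cast_nonneg _
    show E ≤ D.rhoLevel j
    unfold rhoLevel
    linarith
  have hfib : ∀ i : D.ι, ∑' nn : ℕ × ℕ, A.indicator f (i, nn) =
      ({i : D.ι | E ≤ D.Δ i} : Set D.ι).indicator (fun i => D.p i * globalBlock (D.Δ i) (D.spin i) x x) i := by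
    intro i
    by_cases hi : E ≤ D.Δ i
    · have hmem : ∀ nn : ℕ × ℕ, ((i, nn) : D.ι × ℕ × ℕ) ∈ A := fun nn => hi
      rw [indicator_of_mem (show i ∈ ({i : D.ι | E ≤ D.Δ i} : Set D.ι) from hi),
        ← (hasSum_rhoStates_fiber hU i hρ₀).tsum_eq]
      exact tsum_congr fun nn => indicator_of_mem (hmem nn) f
    · have hnot : ∀ nn : ℕ × ℕ, ((i, nn) : D.ι × ℕ × ℕ) ∉ A := fun nn h => hi h
      rw [indicator_of_notMem (show i ∉ ({i : D.ι | E ≤ D.Δ i} : Set D.ι) from hi),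
        tsum_congr (fun nn => indicator_of_notMem (hnot nn) f), tsum_zero]
  have h1 : ∑' i : ↥({i : D.ι | E ≤ D.Δ i} : Set D.ι), D.p i * globalBlock (D.Δ i) (D.spin i) x x =
      ∑' j, A.indicator f j := by
    rw [tsum_subtype ({i : D.ι | E ≤ D.Δ i} : Set D.ι) (fun i => D.p i * globalBlock (D.Δ i) (D.spin i) x x),
      (hS.indicator A).tsum_prod]
    exact (tsum_congr hfib).symm
  rw [h1, tsum_subtype B f]
  exact (hS.indicator A).tsum_le_tsum (fun j => indicator_le_indicator_of_subset hAB hf0 j) (hS.indicator B)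

/-- **The rate with the exact prefactor** (Pappadopulo–Rychkov–Espin–Rattazzi 2012 §5.2, their (5.4) «`≲ Δ_*^{4Δ_φ}|ρ|^{Δ_*}/Γ(4Δ_φ+1)`»,
for the typed class): for every unitary solution of the typed sum rule at `Δ_σ = s > 0`, every `ρ₀ ∈ (0,1)` and `ε > 0`, eventually in `E`:
`Σ'_{i : E ≤ Δ_i} p_i g_i(x₀,x₀) ≤ (16^s(1+2P₀)/Γ(4s+1) + ε) · E^{4s} · ρ₀^E` at `x₀ = 4ρ₀/(1+ρ₀)²` — E.1z's hypothesis-free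
`2(1-ρ₀²)^{-1}·B·E^{4s}ρ₀^E·Et/(Et-4s)` with the Tauberian constant. [cite: PappadopuloRychkovEspinRattazzi2012PRD, §5.2] -/
theorem eventually_rhoTail_le_sharp (hU : D.IsUnitary) (hC : D.SatisfiesCrossing s) (hs : 0 < s) {ρ₀ : ℝ}
    (hρ₀ : ρ₀ ∈ Ioo (0 : ℝ) 1) {ε : ℝ} (hε : 0 < ε) :
    ∀ᶠ E : ℝ in atTop,
      ∑' i : ↥({i : D.ι | E ≤ D.Δ i} : Set D.ι),
          D.p i * globalBlock (D.Δ i) (D.spin i) (4 * ρ₀ / (1 + ρ₀) ^ 2) (4 * ρ₀ / (1 + ρ₀) ^ 2) ≤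
        ((16 : ℝ) ^ s * (1 + 2 * ∑' i : ↥({i : D.ι | D.Δ i = 0} : Set D.ι), D.p i) / Real.Gamma (4 * s + 1) + ε) *
          E ^ (4 * s) * ρ₀ ^ E :=
  (eventually_rhoStatesTail_le hU hC hs hρ₀ hε).mono fun E hE =>
    (rhoTail_le_rhoStatesTail hU (opeConvergent_free hU hC hs) hρ₀ E).trans hE

/-- **No weight at dimension zero: PRER's (5.4) with their normalisation exactly**, eventually
`Σ'_{E ≤ Δ_i} p_i g_i(x₀,x₀) ≤ (16^s/Γ(4s+1) + ε) E^{4s} ρ₀^E`. [cite: PappadopuloRychkovEspinRattazzi2012PRD, §5.2] -/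
theorem eventually_rhoTail_le_sharp_of_pos (hU : D.IsUnitary) (hC : D.SatisfiesCrossing s) (hs : 0 < s)
    (hpos : ∀ i, D.p i ≠ 0 → 0 < D.Δ i) {ρ₀ : ℝ} (hρ₀ : ρ₀ ∈ Ioo (0 : ℝ) 1) {ε : ℝ} (hε : 0 < ε) :
    ∀ᶠ E : ℝ in atTop,
      ∑' i : ↥({i : D.ι | E ≤ D.Δ i} : Set D.ι),
          D.p i * globalBlock (D.Δ i) (D.spin i) (4 * ρ₀ / (1 + ρ₀) ^ 2) (4 * ρ₀ / (1 + ρ₀) ^ 2) ≤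
        ((16 : ℝ) ^ s / Real.Gamma (4 * s + 1) + ε) * E ^ (4 * s) * ρ₀ ^ E := by
  have h := eventually_rhoTail_le_sharp hU hC hs hρ₀ hε
  rw [tsum_p_dim_zero_eq_zero hpos, mul_zero, add_zero, mul_one] at h
  exact h

/-- **At every diagonal point `x₀ ∈ (0,1)`**, with `ρ₀ = ρ(x₀) = (1-√(1-x₀))/(1+√(1-x₀))` written out (`four_mul_rhoZ_div_sq`): eventually
`Σ'_{E ≤ Δ_i} p_i g_i(x₀,x₀) ≤ (16^s(1+2P₀)/Γ(4s+1) + ε) E^{4s} ρ(x₀)^E`. [cite: PappadopuloRychkovEspinRattazzi2012PRD, §5.2] -/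
theorem eventually_rhoTail_le_sharp_rhoZ (hU : D.IsUnitary) (hC : D.SatisfiesCrossing s) (hs : 0 < s) {x₀ : ℝ}
    (hx₀ : x₀ ∈ Ioo (0 : ℝ) 1) {ε : ℝ} (hε : 0 < ε) :
    ∀ᶠ E : ℝ in atTop,
      ∑' i : ↥({i : D.ι | E ≤ D.Δ i} : Set D.ι), D.p i * globalBlock (D.Δ i) (D.spin i) x₀ x₀ ≤
        ((16 : ℝ) ^ s * (1 + 2 * ∑' i : ↥({i : D.ι | D.Δ i = 0} : Set D.ι), D.p i) / Real.Gamma (4 * s + 1) + ε) *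
          E ^ (4 * s) * ((1 - Real.sqrt (1 - x₀)) / (1 + Real.sqrt (1 - x₀))) ^ E := by
  have h := eventually_rhoTail_le_sharp hU hC hs (rhoZ_mem_Ioo hx₀) hε
  rwa [four_mul_rhoZ_div_sq hx₀] at h

end CrossingData

/-! ### The record's class at `Δ_σ = 1/8` -/

/-- **At `Δ_σ = 1/8`, for every datum of the record's class** (binders of E.1u's `record_spectralCount`; all labels `≥ 0.99`, so `P₀ = 0`):
the `ρ`-frame density obeys `F_ρ(E)/E^{1/2} → 16^{1/8}/Γ(3/2)` (`= √2/(√π/2) = 2√(2/π)`), and at the crossing point, for every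
`ε > 0`, eventually `Σ'_{E ≤ Δ_i} p_i g_i(½,½) ≤ (16^{1/8}/Γ(3/2) + ε)·E^{1/2}·ρ(½)^E`, `ρ(½) = 3 - 2√2`. CONTROL-ONLY; no certificate
or number of the record is touched. [folklore] -/
theorem record_rhoSpectralCount (w : ℝ) (D : CrossingData) (hU : D.IsUnitary) (hC : D.SatisfiesCrossing (1 / 8))
    (hT : D.SpinTwoIn ({2} ∪ Ici (2 + 1))) (x : ℝ) (hwx : w ≤ x) (hS : D.ScalarsIn ({x} ∪ Ici 2)) :
    Tendsto (fun E : ℝ => D.rhoSpectralCount E / E ^ (1 / 2 : ℝ)) atTop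
        (𝓝 ((16 : ℝ) ^ (1 / 8 : ℝ) / Real.Gamma (3 / 2))) ∧
      ∀ ε : ℝ, 0 < ε → ∀ᶠ E : ℝ in atTop,
        ∑' i : ↥({i : D.ι | E ≤ D.Δ i} : Set D.ι), D.p i * globalBlock (D.Δ i) (D.spin i) (1 / 2) (1 / 2) ≤
          ((16 : ℝ) ^ (1 / 8 : ℝ) / Real.Gamma (3 / 2) + ε) * E ^ (1 / 2 : ℝ) *
            ((1 - Real.sqrt (1 - 1 / 2)) / (1 + Real.sqrt (1 - 1 / 2))) ^ E := by
  have hx : (99 / 100 : ℝ) < x := ((twoSided_2d_kernel099 w) D hU hC hT x hwx hS).1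
  have hτ : ∀ i, (99 / 100 : ℝ) ≤ D.Δ i := fun i =>
    le_trans (le_min (le_min hx.le (by norm_num)) (by norm_num)) (CrossingData.lowerBound_of_location hU hS i)
  have hpos : ∀ i, D.p i ≠ 0 → 0 < D.Δ i := fun i _ => lt_of_lt_of_le (by norm_num) (hτ i)
  have e1 : (4 : ℝ) * (1 / 8) = 1 / 2 := by norm_num
  have e2 : (4 : ℝ) * (1 / 8) + 1 = 3 / 2 := by norm_num
  have h1 := CrossingData.tendsto_rhoSpectralCount_div_rpow_of_pos hU hC (by norm_num) hpos
  rw [e2] at h1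
  simp only [e1] at h1
  refine ⟨h1, fun ε hε => ?_⟩
  have hhalf : (1 / 2 : ℝ) ∈ Ioo (0 : ℝ) 1 := ⟨by norm_num, by norm_num⟩
  have h2 := CrossingData.eventually_rhoTail_le_sharp_of_pos hU hC (by norm_num) hpos (rhoZ_mem_Ioo hhalf) hε
  rw [four_mul_rhoZ_div_sq hhalf, e2] at h2
  simp only [e1] at h2
  exact h2

end Summit.CriticalPhenomena.Ising3D.Control2D
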